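/-
Origin: expansion seat `planner-pub-hodgecm-qw8b-0`, handover 2026-08-18 (`HOME/pub-hodgecm-qw8b/BalancedHodge.lean`, md5 9170e002, 360 lines);
landed by the gen-6 packager in gate run 22 as `HodgeCM/CM/BalancedHodge.lean` (verbatim).
-/
/-
Copyright: pub-hodgecm formalisation cell (harness21, 2026). New file (not vendored).
Origin: HOME/pub-hodgecm-qw8b/BalancedHodge.lean — session planner-pub-hodgecm-qw8b-0 (unit pub-hodgecm-qw8b),
QW8 seat 2, item (ii) "prove the elementary steps".  Intended final place: `HodgeCM/CM/BalancedHodge.lean`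
(module `HodgeCM.CM.BalancedHodge`).
Unit pub-hodgecm-qw8b (QW8 seat 2), session planner-pub-hodgecm-qw8b-0.
-/
import Summits.HodgeConjecture.HodgeCM.CM.AsymCoeff

/-!
# TypeBalanced weights are Hodge weights, and split into complementary pairs

Pure combinatorics of CM types, continuing `HodgeCM/CM/AsymCoeff.lean` (`lefChar_eq_zero_balanced`: the
Lefschetz character of the weight `(Θ, S)` vanishes iff, for every formal type `Ψ`, the pairs `(j, s)`,
`s ∈ S j`, of pulled-back type `Ψ` and of pulled-back type `Ψ̄` are equinumerous — "balanced").

* `fibreCount Θ S Ψ` — the number of pairs `(j, s)`, `s ∈ S j`, with `pullType (Θ j) s = Ψ`;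
  `card_eq_sum_fibreCount`, `sum_ind_eq_sum_fibreCount`.
* `isHodgeWeight_of_balanced`, `isHodgeWeight_of_lefChar_eq_zero` — **a balanced weight is a Hodge weight**
  (`IsHodgeWeight Θ p S` with `2p = Σ_j |S j|`): for every Galois translate `P` exactly half of the pairs
  `(j, s)` have `P s ∈ Θ_j`, because `P` lies in exactly one of `Ψ`, `Ψ̄`.
* `typeOf`, `fibreCard`, `TypeBalanced` — the same bookkeeping for an arbitrary finite set `A` of pairs
  `⟨j, s⟩` (`fibreCount_eq_fibreCard`, `balanced_sigma_of_lefChar_eq_zero`); `TypeBalanced.exists_pair`,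
  `TypeBalanced.sdiff_pair` (a nonempty balanced set contains a complementary pair, and removing it keeps the
  set balanced), `TypeBalanced.exists_pairing` / `exists_pairing_of_lefChar_eq_zero` — **a balanced weight is
  a disjoint union of complementary pairs**: a list `l` of pairs `(x, y)` with `typeOf y = (typeOf x)‾`
  enumerating the pairs `⟨j, s⟩`, `s ∈ S j`, without repetition.
* `ind_add_ind_of_pullType_eq_barCM` — each complementary pair is itself a degree-2 Hodge weight: for every
  Galois translate `P` exactly one of `P s ∈ Θ`, `P s' ∈ Θ'` holds.

Use (seat `pub-hodgecm-qw8-g2`, in-package proof of `HodgeCM.Universe.Qw8Milne`): a weight vector with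
`achar = 0` has a Hodge weight which splits into complementary pairs, each a degree-2 Hodge weight whose
weight space consists of divisor classes.
-/

open NumberField NumberField.ComplexEmbedding

namespace HodgeCM

open Literature.AlgebraicGeometry.Motives (CMType)
open CMTypeOps
open HodgeCM.Prior.AllgGroup.RfwfAllgGroup
open Finset

noncomputable section

section

variable {F : Type} [Field F] [NumberField F]

attribute [local instance] Classical.propDecidable

/-! ### Fibre counts -/

/-- The number of pairs `(j, s)`, `s ∈ S j`, of pulled-back type `Ψ`. -/
def fibreCount {n : ℕ} (Θ : Fin (n + 1) → CMType F) (S : Fin (n + 1) → Finset (F →+* ℂ))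
    (Ψ : CMF (GalT F) conjT) : ℕ :=
  ∑ j, ((S j).filter (fun s => pullType (Θ j) s = Ψ)).card

/-- (Ported verbatim from the HodgeCMPerL package; no docstring in the source.) -/
theorem card_eq_sum_fibreCount {n : ℕ} (Θ : Fin (n + 1) → CMType F)
    (S : Fin (n + 1) → Finset (F →+* ℂ)) :
    (∑ j, (S j).card) = ∑ Ψ, fibreCount Θ S Ψ := by
  unfold fibreCount
  rw [Finset.sum_comm]
  refine Finset.sum_congr rfl (fun j _ => ?_)
  exact Finset.card_eq_sum_card_fiberwise (fun s _ => Finset.mem_univ (pullType (Θ j) s))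

/-- `lefChar Θ S = 0` iff the weight is balanced (restating `lefChar_eq_zero_balanced` with `fibreCount`). -/
theorem balanced_of_lefChar_eq_zero {n : ℕ} (Θ : Fin (n + 1) → CMType F)
    (S : Fin (n + 1) → Finset (F →+* ℂ)) (h : lefChar Θ S = 0) (Ψ : CMF (GalT F) conjT) :
    fibreCount Θ S Ψ = fibreCount Θ S (barCM Ψ) :=
  lefChar_eq_zero_balanced Θ S h Ψ

/-- The Hodge count `Σ_j Σ_{s ∈ S j} 1_{Θ_j}(P s)` in terms of fibre counts:
`= Σ_Ψ fibreCount(Ψ) · [P ∈ Ψ]`. -/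
theorem sum_ind_eq_sum_fibreCount {n : ℕ} (Θ : Fin (n + 1) → CMType F)
    (S : Fin (n + 1) → Finset (F →+* ℂ)) (P : GalT F) :
    (∑ j, ∑ s ∈ S j, ind (Θ j) (P.1 s)) =
      ((∑ Ψ, fibreCount Θ S Ψ * (if P ∈ Ψ.1 then 1 else 0) : ℕ) : ℤ) := by
  have hind : ∀ (j : Fin (n + 1)) (s : F →+* ℂ),
      ind (Θ j) (P.1 s) = if P ∈ (pullType (Θ j) s).1 then (1 : ℤ) else 0 := by
    intro j s
    unfold ind
    by_cases hs : P.1 s ∈ (Θ j).1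
    · rw [if_pos hs, if_pos ((mem_pullType (Θ j) s P).mpr hs)]
    · rw [if_neg hs, if_neg (fun h' => hs ((mem_pullType (Θ j) s P).mp h'))]
  have key : ∀ j : Fin (n + 1),
      (∑ s ∈ S j, (if P ∈ (pullType (Θ j) s).1 then (1 : ℤ) else 0)) =
        ∑ Ψ, (((S j).filter (fun s => pullType (Θ j) s = Ψ)).card : ℤ) * (if P ∈ Ψ.1 then 1 else 0) := by
    intro j
    rw [← Finset.sum_fiberwise (S j) (fun s => pullType (Θ j) s)
      (fun s => (if P ∈ (pullType (Θ j) s).1 then (1 : ℤ) else 0))]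
    refine Finset.sum_congr rfl (fun Ψ _ => ?_)
    rw [Finset.sum_congr rfl (g := fun _ => if P ∈ Ψ.1 then (1 : ℤ) else 0)
      (fun s hs => by rw [(Finset.mem_filter.mp hs).2]), Finset.sum_const, nsmul_eq_mul]
  simp_rw [hind, key]
  rw [Finset.sum_comm]
  push_cast
  refine Finset.sum_congr rfl (fun Ψ _ => ?_)
  rw [fibreCount, Nat.cast_sum, Finset.sum_mul]

/-- Twice the Hodge count of a balanced weight is its total degree, for every Galois translate. -/
theorem two_mul_sum_fibreCount_ite_of_balanced {n : ℕ} (Θ : Fin (n + 1) → CMType F)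
    (S : Fin (n + 1) → Finset (F →+* ℂ)) (hbal : ∀ Ψ, fibreCount Θ S Ψ = fibreCount Θ S (barCM Ψ))
    (P : GalT F) :
    2 * (∑ Ψ, fibreCount Θ S Ψ * (if P ∈ Ψ.1 then 1 else 0)) = ∑ j, (S j).card := by
  -- reindex one copy of the sum by the involution `barCM`
  let e : CMF (GalT F) conjT ≃ CMF (GalT F) conjT :=
    Function.Involutive.toPerm barCM barCM_barCM
  have hre : (∑ Ψ, fibreCount Θ S Ψ * (if P ∈ Ψ.1 then 1 else 0)) =
      ∑ Ψ, fibreCount Θ S Ψ * (if P ∈ (barCM Ψ).1 then 1 else 0) := by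
    calc (∑ Ψ, fibreCount Θ S Ψ * (if P ∈ Ψ.1 then 1 else 0))
        = ∑ Ψ, fibreCount Θ S (barCM Ψ) * (if P ∈ Ψ.1 then 1 else 0) :=
          Finset.sum_congr rfl (fun Ψ _ => by rw [hbal Ψ])
      _ = ∑ Ψ, fibreCount Θ S Ψ * (if P ∈ (barCM Ψ).1 then 1 else 0) := by
          refine Fintype.sum_equiv e _ _ (fun Ψ => ?_)
          show fibreCount Θ S (barCM Ψ) * (if P ∈ Ψ.1 then 1 else 0) =
            fibreCount Θ S (barCM Ψ) * (if P ∈ (barCM (barCM Ψ)).1 then 1 else 0)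
          rw [barCM_barCM]
  rw [two_mul, card_eq_sum_fibreCount]
  -- `Σ N·[P∈Ψ] + Σ N·[P∈Ψ̄] = Σ N`
  calc (∑ Ψ, fibreCount Θ S Ψ * (if P ∈ Ψ.1 then 1 else 0)) +
        ∑ Ψ, fibreCount Θ S Ψ * (if P ∈ Ψ.1 then 1 else 0)
      = (∑ Ψ, fibreCount Θ S Ψ * (if P ∈ Ψ.1 then 1 else 0)) +
          ∑ Ψ, fibreCount Θ S Ψ * (if P ∈ (barCM Ψ).1 then 1 else 0) := by rw [← hre]
    _ = ∑ Ψ, fibreCount Θ S Ψ * ((if P ∈ Ψ.1 then 1 else 0) + (if P ∈ (barCM Ψ).1 then 1 else 0)) := by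
          rw [← Finset.sum_add_distrib]
          exact Finset.sum_congr rfl (fun Ψ _ => by ring)
    _ = ∑ Ψ, fibreCount Θ S Ψ := by
          refine Finset.sum_congr rfl (fun Ψ _ => ?_)
          by_cases hP : P ∈ Ψ.1
          · rw [if_pos hP, if_neg (fun h' => ((mem_barCM Ψ P).mp h') hP)]; ring
          · rw [if_neg hP, if_pos ((mem_barCM Ψ P).mpr hP)]; ring

/-- **A balanced weight is a Hodge weight** (of degree `p` with `2p = Σ_j |S j|`). -/
theorem isHodgeWeight_of_balanced {n : ℕ} (Θ : Fin (n + 1) → CMType F)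
    (S : Fin (n + 1) → Finset (F →+* ℂ)) (hbal : ∀ Ψ, fibreCount Θ S Ψ = fibreCount Θ S (barCM Ψ)) :
    IsHodgeWeight Θ ((∑ j, (S j).card) / 2) S := by
  have h1 := two_mul_sum_fibreCount_ite_of_balanced Θ S hbal 1
  refine ⟨by omega, fun P => ?_⟩
  have hP := two_mul_sum_fibreCount_ite_of_balanced Θ S hbal P
  rw [sum_ind_eq_sum_fibreCount]
  have : (∑ Ψ, fibreCount Θ S Ψ * (if P ∈ Ψ.1 then 1 else 0)) = (∑ j, (S j).card) / 2 := by omega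
  rw [this]

/-- **A weight with vanishing Lefschetz character is a Hodge weight.** -/
theorem isHodgeWeight_of_lefChar_eq_zero {n : ℕ} (Θ : Fin (n + 1) → CMType F)
    (S : Fin (n + 1) → Finset (F →+* ℂ)) (h : lefChar Θ S = 0) :
    IsHodgeWeight Θ ((∑ j, (S j).card) / 2) S :=
  isHodgeWeight_of_balanced Θ S (balanced_of_lefChar_eq_zero Θ S h)

/-! ### Complementary pairs

We now regard a weight as a finite set `A` of pairs `x = ⟨j, s⟩` (for the weight `(Θ, S)`: `A = univ.sigma S`)
and write `typeOf Θ x = pullType (Θ j) s`. -/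

/-- The pulled-back type of the pair `⟨j, s⟩`. -/
def typeOf {n : ℕ} (Θ : Fin (n + 1) → CMType F) (x : (_ : Fin (n + 1)) × (F →+* ℂ)) :
    CMF (GalT F) conjT :=
  pullType (Θ x.1) x.2

/-- The number of pairs in `A` of pulled-back type `Ψ`. -/
def fibreCard {n : ℕ} (Θ : Fin (n + 1) → CMType F) (A : Finset ((_ : Fin (n + 1)) × (F →+* ℂ)))
    (Ψ : CMF (GalT F) conjT) : ℕ :=
  (A.filter (fun x => typeOf Θ x = Ψ)).card

/-- A finite set of pairs is **balanced** if the types `Ψ` and `Ψ̄` occur equally often in it. -/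
def TypeBalanced {n : ℕ} (Θ : Fin (n + 1) → CMType F) (A : Finset ((_ : Fin (n + 1)) × (F →+* ℂ))) : Prop :=
  ∀ Ψ, fibreCard Θ A Ψ = fibreCard Θ A (barCM Ψ)

/-- (Ported verbatim from the HodgeCMPerL package; no docstring in the source.) -/
theorem fibreCount_eq_fibreCard {n : ℕ} (Θ : Fin (n + 1) → CMType F)
    (S : Fin (n + 1) → Finset (F →+* ℂ)) (Ψ : CMF (GalT F) conjT) :
    fibreCount Θ S Ψ = fibreCard Θ (Finset.univ.sigma S) Ψ := by
  unfold fibreCount fibreCard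
  have : (Finset.univ.sigma S).filter (fun x => typeOf Θ x = Ψ) =
      Finset.univ.sigma (fun j => (S j).filter (fun s => pullType (Θ j) s = Ψ)) := by
    ext ⟨j, s⟩
    simp [Finset.mem_sigma, Finset.mem_filter, typeOf]
  rw [this, Finset.card_sigma]

/-- `lefChar Θ S = 0` ⟹ the set of pairs of the weight `(Θ, S)` is balanced. -/
theorem balanced_sigma_of_lefChar_eq_zero {n : ℕ} (Θ : Fin (n + 1) → CMType F)
    (S : Fin (n + 1) → Finset (F →+* ℂ)) (h : lefChar Θ S = 0) : TypeBalanced Θ (Finset.univ.sigma S) := by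
  intro Ψ
  rw [← fibreCount_eq_fibreCard, ← fibreCount_eq_fibreCard]
  exact balanced_of_lefChar_eq_zero Θ S h Ψ

/-- (Ported verbatim from the HodgeCMPerL package; no docstring in the source.) -/
theorem fibreCard_union {n : ℕ} (Θ : Fin (n + 1) → CMType F)
    {A B : Finset ((_ : Fin (n + 1)) × (F →+* ℂ))} (h : Disjoint A B) (Ψ : CMF (GalT F) conjT) :
    fibreCard Θ (A ∪ B) Ψ = fibreCard Θ A Ψ + fibreCard Θ B Ψ := by
  unfold fibreCard
  rw [Finset.filter_union, Finset.card_union_of_disjoint (Finset.disjoint_filter_filter h)]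

/-- (Ported verbatim from the HodgeCMPerL package; no docstring in the source.) -/
theorem fibreCard_singleton {n : ℕ} (Θ : Fin (n + 1) → CMType F) (x : (_ : Fin (n + 1)) × (F →+* ℂ))
    (Ψ : CMF (GalT F) conjT) : fibreCard Θ {x} Ψ = if typeOf Θ x = Ψ then 1 else 0 := by
  unfold fibreCard
  rw [Finset.filter_singleton]
  by_cases hx : typeOf Θ x = Ψ
  · rw [if_pos hx, if_pos hx, Finset.card_singleton]
  · rw [if_neg hx, if_neg hx, Finset.card_empty]

/-- (Ported verbatim from the HodgeCMPerL package; no docstring in the source.) -/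
theorem fibreCard_pair {n : ℕ} (Θ : Fin (n + 1) → CMType F) {x y : (_ : Fin (n + 1)) × (F →+* ℂ)}
    (hxy : x ≠ y) (Ψ : CMF (GalT F) conjT) :
    fibreCard Θ {x, y} Ψ = (if typeOf Θ x = Ψ then 1 else 0) + (if typeOf Θ y = Ψ then 1 else 0) := by
  rw [Finset.insert_eq, fibreCard_union Θ (Finset.disjoint_singleton_left.mpr (by simpa using hxy)),
    fibreCard_singleton, fibreCard_singleton]

/-- Two pairs of complementary types are distinct. -/
theorem ne_of_typeOf_eq_barCM {n : ℕ} (Θ : Fin (n + 1) → CMType F) {x y : (_ : Fin (n + 1)) × (F →+* ℂ)}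
    (hxy : typeOf Θ y = barCM (typeOf Θ x)) : x ≠ y := by
  rintro rfl
  exact barCM_ne_self _ hxy.symm

/-- A nonempty balanced set of pairs contains a complementary pair. -/
theorem TypeBalanced.exists_pair {n : ℕ} {Θ : Fin (n + 1) → CMType F}
    {A : Finset ((_ : Fin (n + 1)) × (F →+* ℂ))} (hA : TypeBalanced Θ A) (hne : A.Nonempty) :
    ∃ x ∈ A, ∃ y ∈ A, typeOf Θ y = barCM (typeOf Θ x) := by
  obtain ⟨x, hx⟩ := hne
  have hpos : 0 < fibreCard Θ A (typeOf Θ x) := by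
    unfold fibreCard
    exact Finset.card_pos.mpr ⟨x, Finset.mem_filter.mpr ⟨hx, rfl⟩⟩
  rw [hA (typeOf Θ x)] at hpos
  obtain ⟨y, hy⟩ := Finset.card_pos.mp hpos
  exact ⟨x, hx, y, (Finset.mem_filter.mp hy).1, (Finset.mem_filter.mp hy).2⟩

/-- Removing a complementary pair from a balanced set leaves a balanced set. -/
theorem TypeBalanced.sdiff_pair {n : ℕ} {Θ : Fin (n + 1) → CMType F}
    {A : Finset ((_ : Fin (n + 1)) × (F →+* ℂ))} (hA : TypeBalanced Θ A) {x y : (_ : Fin (n + 1)) × (F →+* ℂ)}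
    (hx : x ∈ A) (hy : y ∈ A) (hxy : typeOf Θ y = barCM (typeOf Θ x)) : TypeBalanced Θ (A \ {x, y}) := by
  have hne : x ≠ y := ne_of_typeOf_eq_barCM Θ hxy
  have hsub : ({x, y} : Finset _) ⊆ A := by
    intro z hz
    rw [Finset.mem_insert, Finset.mem_singleton] at hz
    rcases hz with rfl | rfl
    · exact hx
    · exact hy
  have hsplit : ∀ Ψ, fibreCard Θ A Ψ =
      fibreCard Θ (A \ {x, y}) Ψ + ((if typeOf Θ x = Ψ then 1 else 0) + (if typeOf Θ y = Ψ then 1 else 0)) := by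
    intro Ψ
    rw [← fibreCard_pair Θ hne, ← fibreCard_union Θ Finset.sdiff_disjoint, Finset.sdiff_union_of_subset hsub]
  intro Ψ
  have h1 := hA Ψ
  rw [hsplit Ψ, hsplit (barCM Ψ)] at h1
  -- the indicator of `y` at `Ψ` is the indicator of `x` at `Ψ̄`, and vice versa
  have e1 : (typeOf Θ y = Ψ) ↔ (typeOf Θ x = barCM Ψ) := by
    rw [hxy, eq_barCM_iff]
  have e2 : (typeOf Θ y = barCM Ψ) ↔ (typeOf Θ x = Ψ) := by
    rw [hxy]
    exact barCM_injective.eq_iff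
  have i1 : (if typeOf Θ y = Ψ then 1 else 0 : ℕ) = if typeOf Θ x = barCM Ψ then 1 else 0 := by
    by_cases h : typeOf Θ y = Ψ
    · rw [if_pos h, if_pos (e1.mp h)]
    · rw [if_neg h, if_neg (fun h' => h (e1.mpr h'))]
  have i2 : (if typeOf Θ y = barCM Ψ then 1 else 0 : ℕ) = if typeOf Θ x = Ψ then 1 else 0 := by
    by_cases h : typeOf Θ y = barCM Ψ
    · rw [if_pos h, if_pos (e2.mp h)]
    · rw [if_neg h, if_neg (fun h' => h (e2.mpr h'))]
  rw [i1, i2] at h1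
  omega

/-- **A balanced set of pairs is a disjoint union of complementary pairs**: it is enumerated without
repetition by a list of pairs `(x, y)` with `typeOf y = typeOf x̄`. -/
theorem TypeBalanced.exists_pairing {n : ℕ} {Θ : Fin (n + 1) → CMType F}
    {A : Finset ((_ : Fin (n + 1)) × (F →+* ℂ))} (hA : TypeBalanced Θ A) :
    ∃ l : List (((_ : Fin (n + 1)) × (F →+* ℂ)) × ((_ : Fin (n + 1)) × (F →+* ℂ))),
      (∀ q ∈ l, typeOf Θ q.2 = barCM (typeOf Θ q.1)) ∧
      (l.map Prod.fst ++ l.map Prod.snd).Nodup ∧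
      (l.map Prod.fst ++ l.map Prod.snd).toFinset = A := by
  induction' hk : A.card using Nat.strong_induction_on with k ih generalizing A
  by_cases hne : A.Nonempty
  · obtain ⟨x, hx, y, hy, hxy⟩ := hA.exists_pair hne
    have hxy' : x ≠ y := ne_of_typeOf_eq_barCM Θ hxy
    have hsub : ({x, y} : Finset _) ⊆ A := by
      intro z hz
      rw [Finset.mem_insert, Finset.mem_singleton] at hz
      rcases hz with rfl | rfl
      · exact hx
      · exact hy
    have hlt : (A \ {x, y}).card < k := by
      rw [← hk]
      exact Finset.card_lt_card (Finset.sdiff_ssubset hsub ⟨x, by simp⟩)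
    obtain ⟨l, hl1, hl2, hl3⟩ := ih _ hlt (hA.sdiff_pair hx hy hxy) rfl
    refine ⟨(x, y) :: l, ?_, ?_, ?_⟩
    · intro q hq
      rw [List.mem_cons] at hq
      rcases hq with rfl | hq
      · exact hxy
      · exact hl1 q hq
    · -- no repetitions
      have hxmem : x ∉ l.map Prod.fst ++ l.map Prod.snd := by
        intro h
        have := List.mem_toFinset.mpr h
        rw [hl3] at this
        simp at this
      have hymem : y ∉ l.map Prod.fst ++ l.map Prod.snd := by
        intro h
        have := List.mem_toFinset.mpr h
        rw [hl3] at this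
        simp at this
      simp only [List.map_cons, List.cons_append]
      rw [List.nodup_cons, List.nodup_middle, List.nodup_cons]
      refine ⟨?_, ?_, hl2⟩
      · intro h
        rw [List.mem_append, List.mem_cons] at h
        rcases h with h | rfl | h
        · exact hxmem (List.mem_append.mpr (Or.inl h))
        · exact hxy' rfl
        · exact hxmem (List.mem_append.mpr (Or.inr h))
      · exact hymem
    · simp only [List.map_cons, List.cons_append, List.toFinset_cons]
      have hmid : (l.map Prod.fst ++ y :: l.map Prod.snd).toFinset =
          insert y (l.map Prod.fst ++ l.map Prod.snd).toFinset := by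
        ext z
        simp only [List.mem_toFinset, List.mem_append, List.mem_cons, Finset.mem_insert]
        tauto
      rw [hmid, hl3]
      ext z
      simp only [Finset.mem_insert, Finset.mem_sdiff, Finset.mem_singleton, not_or]
      constructor
      · rintro (rfl | rfl | ⟨hz, _⟩)
        · exact hx
        · exact hy
        · exact hz
      · intro hz
        by_cases h1 : z = x
        · exact Or.inl h1
        · by_cases h2 : z = y
          · exact Or.inr (Or.inl h2)
          · exact Or.inr (Or.inr ⟨hz, h1, h2⟩)
  · refine ⟨[], fun q hq => (List.not_mem_nil hq).elim, List.nodup_nil, ?_⟩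
    rw [Finset.not_nonempty_iff_eq_empty] at hne
    simp [hne]

/-- The pairing for the weight `(Θ, S)` with vanishing Lefschetz character: the pairs `(j, s)`, `s ∈ S j`,
are enumerated without repetition by a list of complementary pairs. -/
theorem exists_pairing_of_lefChar_eq_zero {n : ℕ} (Θ : Fin (n + 1) → CMType F)
    (S : Fin (n + 1) → Finset (F →+* ℂ)) (h : lefChar Θ S = 0) :
    ∃ l : List (((_ : Fin (n + 1)) × (F →+* ℂ)) × ((_ : Fin (n + 1)) × (F →+* ℂ))),
      (∀ q ∈ l, pullType (Θ q.2.1) q.2.2 = barCM (pullType (Θ q.1.1) q.1.2)) ∧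
      (l.map Prod.fst ++ l.map Prod.snd).Nodup ∧
      (l.map Prod.fst ++ l.map Prod.snd).toFinset = Finset.univ.sigma S :=
  (balanced_sigma_of_lefChar_eq_zero Θ S h).exists_pairing

/-- Each complementary pair is itself a (degree-2) Hodge weight: for every Galois translate `P` exactly one
of `P s ∈ Θ_j`, `P s' ∈ Θ_{j'}` holds. -/
theorem ind_add_ind_of_pullType_eq_barCM {Θ Θ' : CMType F} {s s' : F →+* ℂ}
    (h : pullType Θ' s' = barCM (pullType Θ s)) (P : GalT F) :
    ind Θ (P.1 s) + ind Θ' (P.1 s') = 1 := by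
  have key : P.1 s' ∈ Θ'.1 ↔ P.1 s ∉ Θ.1 := by
    rw [← mem_pullType Θ' s' P, h, mem_barCM, mem_pullType]
  unfold ind
  by_cases hs : P.1 s ∈ Θ.1
  · rw [if_pos hs, if_neg (fun h' => (key.mp h') hs)]; rfl
  · rw [if_neg hs, if_pos (key.mpr hs)]; rfl

end

end

end HodgeCM
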